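import Mathlib.Analysis.SpecialFunctions.Pow.Real
import Mathlib.Analysis.SpecificLimits.Basic
import Summits.AnomalousDissipation.AnomalousDissipation.Theorems.SawtoothPulseCascadeK1LocalisedCascadeLedgerClassChain

/-!
# K1loc, line `Spectral` / thin start — helper: PHASE SUMS (per-phase junk → one geometric majorant for the energy-ledger closer)

Helper file of the prover lane on the crux `K1LocalisedCascade` (stmt-AnomalousDissipation-19491), route `SawtoothPulseCascade`
(glue seat; the NUMERIC LAYER of the concrete ledger assembly, part III).  The canonical class steps
(`K1Window.ratioClass_{v,h}step_canonical_le`, `strip_vstep_canonical_le`, `lowFibre_hstep_canonical_le`) leave at phase `j` the junk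
`J_j = 3r*²((4/3)(A*πGη_jΛ₀(j)2^{M_b(j)}/N_j)² + 128N_jA*τ₀(j) + 8M_b(j)A*²M_jδ_j/π)` (`τ₀(j) ∝ 1/Λ₀(j)`,
`M_j = max 1 √(2log(1/η_j))`, `δ_j = δ₀/2^j`) plus the far part; the closer `K1Ledger.From.k1Localised_of_class_energy_ledger_geometric`
wants ONE geometric majorant `e_{j₀+i} ≤ C_e·θ^i`.  This file supplies the conversions:
* §1 zone depth of a geometric rounding target is AFFINE in the phase (`zoneDepth_le_affine`), or — with a LINEAR zone depth — the
  rounding target is Gaussian-small hence below any geometric sequence (`exp_neg_sq_half_affine_le`);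
* §2 polynomial × geometric ≤ geometric: `j·ρ^j ≤ 1/(1−ρ)`, `j²·ρ^j ≤ 1/(1−√ρ)²`, and
  `(a + bj + cj²)θ^j ≤ (a + b/(1−θ/θ′) + c/(1−√(θ/θ′))²)·θ′^j` (`quadratic_mul_pow_le_geometric`) — the zone part
  (affine block count × affine zone depth × `δ₀2^{−j}`) and the kernel-layer part (`∝ (ρ_N/g)^j`) become one `C_e·θ′^i`;
  `(α + βj)/2^j ≤ α + β` (`affine_div_two_pow_le`) for the uniform side condition `M_jδ_j < π/2`;
* §3 three geometric terms into one (`geometric3_le`), and the threshold schedule `K_j = K₀·g^j` against the closer's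
  `(1 + 1/250)·c·(γ²−3)^n ≤ K_n` (`schedule_hcK`).
Pure real arithmetic; no definitions; no statement about the crux. [cite: Grafakos2014, Prop. 3.2.7 (3)] [problem: turb]
-/

-- `Summit.<Summit>.<Problem>`: single-conjunct summit, the duplicate namespace segment is deliberate.
set_option linter.dupNamespace false

noncomputable section

namespace Summit.AnomalousDissipation.AnomalousDissipation.Theorems.SawtoothPulseCascade.K1Window

open Finset
open Summit.AnomalousDissipation.AnomalousDissipation.Theorems.SawtoothPulseCascade.K1Ledger.From

/-! ## §1 Zone depth along the phases -/

/-- `√j ≤ j` for a natural number `j`. [folklore] -/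
theorem sqrt_natCast_le_self (j : ℕ) : Real.sqrt (j : ℝ) ≤ j := by
  rcases Nat.eq_zero_or_pos j with rfl | hj
  · simp
  · have h1 : (1 : ℝ) ≤ j := by exact_mod_cast hj
    rw [Real.sqrt_le_left (by linarith)]
    nlinarith

/-- **Zone depth of a geometric rounding target is affine in the phase**: for `η_j = η₀θ^j` (`η₀ > 0`, `0 < θ ≤ 1`),
`max 1 √(2log(1/η_j)) ≤ 1 + √(2log(1/η₀)) + √(2log(1/θ))·j` (the `M` of `K1Window.zoneDepth_facts` at `η = η_j`). [folklore] -/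
theorem zoneDepth_le_affine {η₀ θ : ℝ} (hη₀ : 0 < η₀) (hθ : 0 < θ) (hθ1 : θ ≤ 1) (j : ℕ) :
    max 1 (Real.sqrt (2 * Real.log (1 / (η₀ * θ ^ j)))) ≤
      1 + Real.sqrt (2 * Real.log (1 / η₀)) + Real.sqrt (2 * Real.log (1 / θ)) * j := by
  have hlog : Real.log (1 / (η₀ * θ ^ j)) = Real.log (1 / η₀) + j * Real.log (1 / θ) := by
    rw [one_div, one_div, one_div, Real.log_inv, Real.log_inv, Real.log_inv, Real.log_mul hη₀.ne' (pow_ne_zero _ hθ.ne'),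
      Real.log_pow]
    ring
  have hB : 0 ≤ Real.log (1 / θ) := Real.log_nonneg (by rw [le_div_iff₀ hθ]; linarith)
  have h1 : Real.sqrt (2 * Real.log (1 / (η₀ * θ ^ j))) ≤
      Real.sqrt (2 * Real.log (1 / η₀)) + Real.sqrt (2 * Real.log (1 / θ)) * j := by
    rw [hlog, mul_add]
    refine (sqrt_add_le_sqrt_add _ _).trans (add_le_add le_rfl ?_)
    rw [show 2 * ((j : ℝ) * Real.log (1 / θ)) = (2 * Real.log (1 / θ)) * j by ring,
      Real.sqrt_mul (by positivity)]
    exact mul_le_mul_of_nonneg_left (sqrt_natCast_le_self j) (Real.sqrt_nonneg _)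
  have h0 : 0 ≤ Real.sqrt (2 * Real.log (1 / η₀)) + Real.sqrt (2 * Real.log (1 / θ)) * j := by positivity
  refine max_le (by linarith) (by linarith)

/-- **Linear zone depth makes the rounding target Gaussian-small**: `s ≥ 0` gives
`exp(−(M₀ + s·j)²/2) ≤ exp(−M₀²/2)·(exp(−M₀s))^j` — below any prescribed geometric sequence once `M₀s ≥ log(1/θ)`. [folklore] -/
theorem exp_neg_sq_half_affine_le (M₀ : ℝ) {s : ℝ} (hs : 0 ≤ s) (j : ℕ) :
    Real.exp (-((M₀ + s * j) ^ 2 / 2)) ≤ Real.exp (-(M₀ ^ 2 / 2)) * Real.exp (-(M₀ * s)) ^ j := by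
  rw [← Real.exp_nat_mul, ← Real.exp_add]
  refine Real.exp_le_exp.mpr ?_
  have hj : (0 : ℝ) ≤ j := Nat.cast_nonneg j
  nlinarith [mul_nonneg (mul_nonneg hs hs) (mul_nonneg hj hj)]

/-- With `M₀·s ≥ log(1/θ)` (`θ > 0`): `exp(−M₀s)^j ≤ θ^j`. [folklore] -/
theorem exp_neg_mul_pow_le {M₀ s θ : ℝ} (hθ : 0 < θ) (h : Real.log (1 / θ) ≤ M₀ * s) (j : ℕ) :
    Real.exp (-(M₀ * s)) ^ j ≤ θ ^ j := by
  refine pow_le_pow_left₀ (Real.exp_pos _).le ?_ j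
  have h1 : -(M₀ * s) ≤ Real.log θ := by
    rw [one_div, Real.log_inv] at h; linarith
  calc Real.exp (-(M₀ * s)) ≤ Real.exp (Real.log θ) := Real.exp_le_exp.mpr h1
    _ = θ := Real.exp_log hθ

/-! ## §2 Polynomial × geometric ≤ geometric -/

/-- `j·ρ^j ≤ 1/(1−ρ)` for `0 ≤ ρ < 1` (since `j·ρ^j ≤ Σ_{k<j} ρ^k`). [folklore] -/
theorem natCast_mul_pow_le {ρ : ℝ} (hρ0 : 0 ≤ ρ) (hρ1 : ρ < 1) (j : ℕ) : (j : ℝ) * ρ ^ j ≤ 1 / (1 - ρ) := by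
  have h1 : (j : ℝ) * ρ ^ j = ∑ _k ∈ range j, ρ ^ j := by rw [sum_const, card_range, nsmul_eq_mul]
  have h2 : ∑ _k ∈ range j, ρ ^ j ≤ ∑ k ∈ range j, ρ ^ k :=
    sum_le_sum fun k hk => pow_le_pow_of_le_one hρ0 hρ1.le (mem_range.mp hk).le
  have hs : Summable fun k : ℕ => ρ ^ k := summable_geometric_of_lt_one hρ0 hρ1
  have h3 : ∑ k ∈ range j, ρ ^ k ≤ ∑' k : ℕ, ρ ^ k := hs.sum_le_tsum _ fun k _ => pow_nonneg hρ0 k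
  rw [h1]
  refine h2.trans (h3.trans (le_of_eq ?_))
  rw [tsum_geometric_of_lt_one hρ0 hρ1, one_div]

/-- `j²·ρ^j ≤ 1/(1−√ρ)²` for `0 ≤ ρ < 1` (`j²ρ^j = (j(√ρ)^j)²`). [folklore] -/
theorem natCast_sq_mul_pow_le {ρ : ℝ} (hρ0 : 0 ≤ ρ) (hρ1 : ρ < 1) (j : ℕ) :
    (j : ℝ) ^ 2 * ρ ^ j ≤ 1 / (1 - Real.sqrt ρ) ^ 2 := by
  have hs0 : 0 ≤ Real.sqrt ρ := Real.sqrt_nonneg ρ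
  have hs1 : Real.sqrt ρ < 1 := by
    calc Real.sqrt ρ < Real.sqrt 1 := Real.sqrt_lt_sqrt hρ0 hρ1
      _ = 1 := Real.sqrt_one
  have h := natCast_mul_pow_le hs0 hs1 j
  have h0 : 0 ≤ (j : ℝ) * Real.sqrt ρ ^ j := by positivity
  have e : (j : ℝ) ^ 2 * ρ ^ j = ((j : ℝ) * Real.sqrt ρ ^ j) ^ 2 := by
    rw [mul_pow, ← pow_mul, mul_comm j 2, pow_mul, Real.sq_sqrt hρ0]
  rw [e, show 1 / (1 - Real.sqrt ρ) ^ 2 = (1 / (1 - Real.sqrt ρ)) ^ 2 by rw [div_pow, one_pow]]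
  exact pow_le_pow_left₀ h0 h 2

/-- **Quadratic × geometric below a slower geometric**: `0 ≤ θ < θ′`, `a, b, c ≥ 0`, `ρ := θ/θ′` give
`(a + b·j + c·j²)·θ^j ≤ (a + b/(1−ρ) + c/(1−√ρ)²)·θ′^j` for every `j` — the form `C_e·θ′^i` of
`K1Ledger.From.k1Localised_of_class_energy_ledger_geometric`. [folklore] -/
theorem quadratic_mul_pow_le_geometric {a b c θ θ' : ℝ} (ha : 0 ≤ a) (hb : 0 ≤ b) (hc : 0 ≤ c) (hθ : 0 ≤ θ)
    (hθθ' : θ < θ') (j : ℕ) :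
    (a + b * j + c * (j : ℝ) ^ 2) * θ ^ j ≤
      (a + b * (1 / (1 - θ / θ')) + c * (1 / (1 - Real.sqrt (θ / θ')) ^ 2)) * θ' ^ j := by
  have hθ' : 0 < θ' := lt_of_le_of_lt hθ hθθ'
  set ρ := θ / θ' with hρ
  have hρ0 : 0 ≤ ρ := div_nonneg hθ hθ'.le
  have hρ1 : ρ < 1 := (div_lt_one hθ').mpr hθθ'
  have e : θ ^ j = ρ ^ j * θ' ^ j := by
    rw [hρ, div_pow, div_mul_cancel₀ _ (pow_ne_zero _ hθ'.ne')]
  rw [e, ← mul_assoc]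
  refine mul_le_mul_of_nonneg_right ?_ (pow_nonneg hθ'.le _)
  have h1 : ρ ^ j ≤ 1 := pow_le_one₀ hρ0 hρ1.le
  have h2 := natCast_mul_pow_le hρ0 hρ1 j
  have h3 := natCast_sq_mul_pow_le hρ0 hρ1 j
  have hj : (0 : ℝ) ≤ j := Nat.cast_nonneg j
  calc (a + b * j + c * (j : ℝ) ^ 2) * ρ ^ j = a * ρ ^ j + b * ((j : ℝ) * ρ ^ j) + c * ((j : ℝ) ^ 2 * ρ ^ j) := by ring
    _ ≤ a * 1 + b * (1 / (1 - ρ)) + c * (1 / (1 - Real.sqrt ρ) ^ 2) := by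
        refine add_le_add (add_le_add ?_ ?_) ?_
        · exact mul_le_mul_of_nonneg_left h1 ha
        · exact mul_le_mul_of_nonneg_left h2 hb
        · exact mul_le_mul_of_nonneg_left h3 hc
    _ = _ := by ring

/-- **Uniform side condition along the phases**: `(α + β·j)/2^j ≤ α + β` (`α, β ≥ 0`) — e.g. `M_jδ_j = (α + βj)δ₀/2^j < π/2` for all
`j` as soon as `(α + β)δ₀ < π/2`. [folklore] -/
theorem affine_div_two_pow_le {α β : ℝ} (hα : 0 ≤ α) (hβ : 0 ≤ β) (j : ℕ) : (α + β * j) / 2 ^ j ≤ α + β := by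
  have h2 : (1 : ℝ) ≤ 2 ^ j := one_le_pow₀ (by norm_num)
  have hj : (j : ℝ) ≤ 2 ^ j := by exact_mod_cast (Nat.lt_two_pow_self).le
  rw [div_le_iff₀ (by positivity)]
  nlinarith

/-! ## §3 Several geometric terms; the threshold schedule -/

/-- **Three geometric terms into one**: nonnegative `α, β, γ` and ratios `0 ≤ θ₁, θ₂, θ₃` give
`αθ₁^i + βθ₂^i + γθ₃^i ≤ (α + β + γ)·(max θ₁ (max θ₂ θ₃))^i`. [folklore] -/
theorem geometric3_le {α β γ θ₁ θ₂ θ₃ : ℝ} (hα : 0 ≤ α) (hβ : 0 ≤ β) (hγ : 0 ≤ γ) (h₁ : 0 ≤ θ₁) (h₂ : 0 ≤ θ₂)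
    (h₃ : 0 ≤ θ₃) (i : ℕ) :
    α * θ₁ ^ i + β * θ₂ ^ i + γ * θ₃ ^ i ≤ (α + β + γ) * (max θ₁ (max θ₂ θ₃)) ^ i := by
  set θ := max θ₁ (max θ₂ θ₃) with hθ
  have e1 : θ₁ ^ i ≤ θ ^ i := pow_le_pow_left₀ h₁ (le_max_left _ _) i
  have e2 : θ₂ ^ i ≤ θ ^ i := pow_le_pow_left₀ h₂ ((le_max_left _ _).trans (le_max_right _ _)) i
  have e3 : θ₃ ^ i ≤ θ ^ i := pow_le_pow_left₀ h₃ ((le_max_right _ _).trans (le_max_right _ _)) i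
  calc α * θ₁ ^ i + β * θ₂ ^ i + γ * θ₃ ^ i ≤ α * θ ^ i + β * θ ^ i + γ * θ ^ i :=
        add_le_add (add_le_add (mul_le_mul_of_nonneg_left e1 hα) (mul_le_mul_of_nonneg_left e2 hβ))
          (mul_le_mul_of_nonneg_left e3 hγ)
    _ = (α + β + γ) * θ ^ i := by ring

/-- **Two geometric terms into one** (special case). [folklore] -/
theorem geometric2_le {α β θ₁ θ₂ : ℝ} (hα : 0 ≤ α) (hβ : 0 ≤ β) (h₁ : 0 ≤ θ₁) (h₂ : 0 ≤ θ₂) (i : ℕ) :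
    α * θ₁ ^ i + β * θ₂ ^ i ≤ (α + β) * (max θ₁ θ₂) ^ i := by
  have e1 : θ₁ ^ i ≤ (max θ₁ θ₂) ^ i := pow_le_pow_left₀ h₁ (le_max_left _ _) i
  have e2 : θ₂ ^ i ≤ (max θ₁ θ₂) ^ i := pow_le_pow_left₀ h₂ (le_max_right _ _) i
  calc α * θ₁ ^ i + β * θ₂ ^ i ≤ α * (max θ₁ θ₂) ^ i + β * (max θ₁ θ₂) ^ i :=
        add_le_add (mul_le_mul_of_nonneg_left e1 hα) (mul_le_mul_of_nonneg_left e2 hβ)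
    _ = (α + β) * (max θ₁ θ₂) ^ i := by ring

/-- **Shifting a geometric majorant to the start phase**: `x ≤ C·θ^(j₀+i)` is `x ≤ (C·θ^j₀)·θ^i`. [folklore] -/
theorem mul_pow_add_eq (C θ : ℝ) (j₀ i : ℕ) : C * θ ^ (j₀ + i) = C * θ ^ j₀ * θ ^ i := by
  rw [pow_add, mul_assoc]

/-- **The threshold schedule `K_j = K₀·g^j` meets the closer's growth condition**: for `0 ≤ r ≤ g` (`r = γ² − 3`) and every `n`,
`(1 + 1/250)·((K₀/(1 + 1/250))·rⁿ) ≤ K₀·gⁿ` — the `hcK` hypothesis of `K1Ledger.From.k1Localised_of_class_energy_ledger` with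
`c := K₀/(1 + 1/250)`. [folklore] -/
theorem schedule_hcK {K₀ g : ℕ} {r : ℝ} (hr0 : 0 ≤ r) (hrg : r ≤ g) (n : ℕ) :
    (1 + 1 / 250) * ((K₀ : ℝ) / (1 + 1 / 250) * r ^ n) ≤ ((K₀ * g ^ n : ℕ) : ℝ) := by
  have e : (1 + 1 / 250) * ((K₀ : ℝ) / (1 + 1 / 250) * r ^ n) = K₀ * r ^ n := by
    field_simp
  rw [e]
  push_cast
  exact mul_le_mul_of_nonneg_left (pow_le_pow_left₀ hr0 hrg n) (Nat.cast_nonneg _)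

/-- The schedule constant is positive for `K₀ ≥ 1` (the `hc` hypothesis of the closer). [folklore] -/
theorem schedule_c_pos {K₀ : ℕ} (hK₀ : 1 ≤ K₀) : 0 < (K₀ : ℝ) / (1 + 1 / 250) := by
  have : (1 : ℝ) ≤ K₀ := by exact_mod_cast hK₀
  positivity

/-- The schedule is monotone for `g ≥ 1`. [folklore] -/
theorem schedule_monotone {K₀ g : ℕ} (hg : 1 ≤ g) : Monotone fun j : ℕ => K₀ * g ^ j :=
  fun _ _ h => Nat.mul_le_mul_left _ (Nat.pow_le_pow_right hg h)

/-- Cast of the schedule. [folklore] -/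
theorem cast_schedule (K₀ g j : ℕ) : ((K₀ * g ^ j : ℕ) : ℝ) = (K₀ : ℝ) * (g : ℝ) ^ j := by push_cast; ring

/-- **Phase ratios along the schedule**: `N₀ρ^j / (K₀g^j) = (N₀/K₀)·(ρ/g)^j` (`K₀, g > 0`) — the kernel-layer part
`128·N_j·A*·τ₀(j)` with `τ₀(j) ∝ 1/Λ₀(j)`, `Λ₀(j) = K₀g^j`, `N_j = N₀ρ_N^j`. [folklore] -/
theorem pow_div_schedule_eq {N₀ ρ : ℝ} {K₀ g : ℕ} (hK₀ : 0 < K₀) (hg : 0 < g) (j : ℕ) :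
    N₀ * ρ ^ j / ((K₀ * g ^ j : ℕ) : ℝ) = N₀ / K₀ * (ρ / g) ^ j := by
  have hK : (0 : ℝ) < K₀ := by exact_mod_cast hK₀
  have hgr : (0 : ℝ) < g := by exact_mod_cast hg
  rw [cast_schedule, div_pow]
  field_simp

end Summit.AnomalousDissipation.AnomalousDissipation.Theorems.SawtoothPulseCascade.K1Window
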